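/-
Route `LevelGradedCohnUmans`, crux `SubgroupIdentityDesigns` (stmt-MatrixMultiplication-14079).
Cell B2b-5 (`b2b-lgcu-borel`, gen 6).  HONEST FRAMING: the VALUE here is a THEOREM / a DECIDABLE
VERDICT / a CERTIFICATE — NOT summit progress.  This file builds an explicit infinite Borel TPP family in `GL₂(𝔽_p)` with a
rank-`≤ 1` identity test; it says nothing about the small-`ε` regime that would bear on `ω`.
-/
import Mathlib
import Summits.MatrixMultiplication.MatrixMultiplication.Theorems.SubgroupIdentityDesigns.Negative.BorelLevelOne

/-!
# `SubgroupIdentityDesigns`: the Borel family `F`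

For a prime `p` with `-1` and `2` both non-squares mod `p` (i.e. `p ≡ 3 (mod 8)`) put, inside the
upper Borel subgroup of `GL₂(𝔽_p)`,

* `A₁ = {diag(±1, z)}`                                   (`|A₁| = 2(p-1)`),
* `A₂ = u₁ · {diag(x, e) : x a square, e = ±1} · u₁⁻¹`   (`|A₂| = p-1`),
* `A₃ = u₂ · {diag(z², z)} · u₂⁻¹`                       (`|A₃| = p-1`),

where `u_y = [[1, y], [0, 1]]`.  Then

1. `(A₁, A₂, A₃)` has the subgroup TPP (`borelFamily_tpp`): `a₁a₂a₃ = 1` forces the sign in `a₁`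
   to be a square (so `+1`), and then the off-diagonal entry gives `e·x₃² - 2x₃ + 1 = 0`, i.e.
   `x₃ = 1` (`e = 1`) or `(x₃+1)² = 2` (`e = -1`, impossible);
2. if some `t₀` has `t₀² - 4` and `t₀² + 4` both non-squares then the unipotent `u_{t₀-2}` is not
   in `A₁A₂A₃` (`borelFamily_missing`), so by the level-one Borel identity test
   (`levelOne_idDesign_of_borel`, file `BorelLevelOne`) the triple carries a rank-`≤ 1` Fourier
   test function that is `1` at the identity and `0` on `A₁A₂A₃ ∖ {1}`;
3. `|A₁||A₂||A₃| = 2(p-1)³` (`borelFamily_card`).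

The package is `borelFamily`.  (Numerically the family works for every `p ≡ 3 (mod 8)`, `p ≥ 11`,
since `#{t : t² ± 4 both non-squares} = (p-3)/4`; Borel triples have `|A₁||A₂||A₃| ≤ (p-1)⁴` and
can never reach `ε < 1`.)  The consequences for the crux are drawn in `BorelLargeEps`.
[folklore computations; family and test: this cell]
-/

noncomputable section

open scoped BigOperators Classical
open Summit.MatrixMultiplication.MatrixMultiplication.Theorems.LieRankDesigns.Negative

namespace Summit.MatrixMultiplication.MatrixMultiplication.Theorems.SubgroupIdentityDesigns.Negative

variable {p : ℕ} [Fact p.Prime]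

/-! ## Upper-triangular elements `[[a, y], [0, z]]` -/

/-- The upper-triangular element `[[a, y], [0, z]]` of `GL₂(𝔽_p)` (`a, z` units). -/
def upperTri (a z : (ZMod p)ˣ) (y : ZMod p) : GLm p 2 :=
  Matrix.GeneralLinearGroup.mkOfDetNeZero !![(a : ZMod p), y; 0, (z : ZMod p)]
    (by rw [Matrix.det_fin_two_of]; simp [a.ne_zero, z.ne_zero])

/-- The underlying matrix of `upperTri a z y`. -/
@[simp] theorem upperTri_val (a z : (ZMod p)ˣ) (y : ZMod p) :
    ((upperTri a z y : GLm p 2) : Mat p 2) = !![(a : ZMod p), y; 0, (z : ZMod p)] := rfl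

/-- Product of two upper-triangular elements. [folklore] -/
theorem upperTri_mul (a z a' z' : (ZMod p)ˣ) (y y' : ZMod p) :
    upperTri a z y * upperTri a' z' y' =
      upperTri (a * a') (z * z') ((a : ZMod p) * y' + y * z') := by
  apply Units.ext
  rw [Units.val_mul, upperTri_val, upperTri_val, upperTri_val, Matrix.mul_fin_two]
  push_cast
  simp

/-- `[[1, 0], [0, 1]]` is the identity. -/
@[simp] theorem upperTri_one : upperTri (1 : (ZMod p)ˣ) 1 0 = (1 : GLm p 2) := by
  apply Units.ext
  rw [upperTri_val]
  simp [Matrix.one_fin_two]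

/-- `upperTri` is injective in `(a, z, y)`. -/
theorem upperTri_injective {a z a' z' : (ZMod p)ˣ} {y y' : ZMod p}
    (h : upperTri a z y = upperTri a' z' y') : a = a' ∧ z = z' ∧ y = y' := by
  have h' := congrArg (fun g : GLm p 2 => (g : Mat p 2)) h
  simp only [upperTri_val] at h'
  have h00 := congrFun (congrFun h' 0) 0
  have h01 := congrFun (congrFun h' 0) 1
  have h11 := congrFun (congrFun h' 1) 1
  simp at h00 h01 h11
  exact ⟨Units.ext h00, Units.ext h11, h01⟩

/-- `upperTri a z y` is upper triangular. -/
theorem upperTri_lower (a z : (ZMod p)ˣ) (y : ZMod p) :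
    ((upperTri a z y : GLm p 2) : Mat p 2) 1 0 = 0 := by
  simp

/-- `u(y) = [[1, y], [0, 1]]` as an `upperTri`. -/
theorem unipUpper_eq_upperTri (y : ZMod p) : unipUpper y = upperTri 1 1 y :=
  Units.ext (by rw [upperTri_val]; simp [unipUpper])

/-! ## Arithmetic in `𝔽_p` under `-1 ∉ (𝔽_p)²` -/

/-- If `-1` is a non-square mod `p` then `p ≠ 2`. [folklore] -/
theorem two_ne_of_neg_one_nonsquare (hneg : ¬IsSquare (-1 : ZMod p)) : p ≠ 2 := by
  intro hp
  apply hneg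
  rw [ZMod.exists_sq_eq_neg_one_iff, hp]
  norm_num

/-- If `-1` is a non-square then `-1 ≠ 1`. [folklore] -/
theorem neg_one_ne_one_of_nonsquare (hneg : ¬IsSquare (-1 : ZMod p)) : (-1 : ZMod p) ≠ 1 :=
  fun h => hneg ⟨1, by rw [h, mul_one]⟩

/-- `e² = 1` for `e = x^{(p-1)/2}`, `x ≠ 0`. -/
theorem pow_half_sq (hp2 : p ≠ 2) {x : ZMod p} (hx : x ≠ 0) : (x ^ (p / 2)) ^ 2 = 1 := by
  rw [← pow_mul, mul_comm, Nat.two_mul_odd_div_two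
    ((Fact.out : p.Prime).eq_two_or_odd.resolve_left hp2)]
  exact ZMod.pow_card_sub_one_eq_one hx

/-- Euler's criterion for `-1`: `(-1)^{(p-1)/2} = -1` when `-1 ∉ (𝔽_p)²`. [folklore] -/
theorem neg_one_pow_half (hneg : ¬IsSquare (-1 : ZMod p)) : (-1 : ZMod p) ^ (p / 2) = -1 := by
  have hne : (-1 : ZMod p) ≠ 0 := neg_ne_zero.mpr one_ne_zero
  rcases ZMod.pow_div_two_eq_neg_one_or_one p hne with h | h
  · exact absurd ((ZMod.euler_criterion p hne).mpr h) hneg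
  · exact h

/-- If `u² = 1` and `u^{(p-1)/2} = 1` then `u = 1` (as `(-1)^{(p-1)/2} = -1`). -/
theorem eq_one_of_sq_of_pow_half (hneg : ¬IsSquare (-1 : ZMod p)) {u : ZMod p}
    (h1 : u ^ 2 = 1) (h2 : u ^ (p / 2) = 1) : u = 1 := by
  rw [sq, mul_self_eq_one_iff] at h1
  rcases h1 with h1 | h1
  · exact h1
  · rw [h1, neg_one_pow_half hneg] at h2
    exact absurd h2 (neg_one_ne_one_of_nonsquare hneg)

/-- `e² = 1 ⇒ e = ±1` in a field. [folklore] -/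
theorem sq_eq_one_or (e : ZMod p) (he : e ^ 2 = 1) : e = 1 ∨ e = -1 := by
  rwa [sq, mul_self_eq_one_iff] at he

/-! ## The three tori -/

/-- `ℤˣ = {±1} → 𝔽_pˣ`. -/
def signHom (p : ℕ) [Fact p.Prime] : ℤˣ →* (ZMod p)ˣ :=
  Units.map (Int.castRingHom (ZMod p)).toMonoidHom

/-- `signHom 1 = 1`. -/
@[simp] theorem signHom_one_val : ((signHom p 1 : (ZMod p)ˣ) : ZMod p) = 1 := by
  simp [signHom]

/-- `signHom (-1) = -1`. -/
@[simp] theorem signHom_neg_one_val : ((signHom p (-1) : (ZMod p)ˣ) : ZMod p) = -1 := by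
  simp [signHom]

/-- `A₁ = {diag(±1, z)}` as the range of `(s, z) ↦ diag(s, z)`. -/
def torusA (p : ℕ) [Fact p.Prime] : ℤˣ × (ZMod p)ˣ →* GLm p 2 where
  toFun sz := upperTri (signHom p sz.1) sz.2 0
  map_one' := by simp
  map_mul' x y := by
    rw [upperTri_mul, Prod.fst_mul, Prod.snd_mul, map_mul, mul_zero, zero_mul, add_zero]

/-- `A₂ = u₁ {diag(x, e) : x ∈ (𝔽_pˣ)², e = ±1} u₁⁻¹`, parametrised by `w ↦ (w², w^{(p-1)/2})`. -/
def torusB (p : ℕ) [Fact p.Prime] : (ZMod p)ˣ →* GLm p 2 where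
  toFun w := upperTri (w ^ 2) (w ^ (p / 2)) ((w : ZMod p) ^ (p / 2) - (w : ZMod p) ^ 2)
  map_one' := by simp
  map_mul' w w' := by
    rw [upperTri_mul]
    congr 1
    · exact mul_pow _ _ _
    · exact mul_pow _ _ _
    · push_cast; ring

/-- `A₃ = u₂ {diag(z², z)} u₂⁻¹`. -/
def torusC (p : ℕ) [Fact p.Prime] : (ZMod p)ˣ →* GLm p 2 where
  toFun w := upperTri (w ^ 2) w (2 * ((w : ZMod p) - (w : ZMod p) ^ 2))
  map_one' := by simp
  map_mul' w w' := by
    rw [upperTri_mul]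
    congr 1
    · exact mul_pow _ _ _
    · push_cast; ring

/-- Unfolding `torusA`. -/
theorem torusA_apply (s : ℤˣ) (z : (ZMod p)ˣ) :
    torusA p (s, z) = upperTri (signHom p s) z 0 := rfl

/-- Unfolding `torusB`. -/
theorem torusB_apply (w : (ZMod p)ˣ) :
    torusB p w = upperTri (w ^ 2) (w ^ (p / 2)) ((w : ZMod p) ^ (p / 2) - (w : ZMod p) ^ 2) :=
  rfl

/-- Unfolding `torusC`. -/
theorem torusC_apply (w : (ZMod p)ˣ) :
    torusC p w = upperTri (w ^ 2) w (2 * ((w : ZMod p) - (w : ZMod p) ^ 2)) := rfl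

/-- The generic triple product, as one upper-triangular element. -/
theorem triple_product (s : ℤˣ) (z₁ w₂ w₃ : (ZMod p)ˣ) :
    torusA p (s, z₁) * torusB p w₂ * torusC p w₃ =
      upperTri (signHom p s * w₂ ^ 2 * w₃ ^ 2) (z₁ * w₂ ^ (p / 2) * w₃)
        ((signHom p s : ZMod p) * ((w₂ : ZMod p) ^ 2 * (2 * ((w₃ : ZMod p) - (w₃ : ZMod p) ^ 2))
          + ((w₂ : ZMod p) ^ (p / 2) - (w₂ : ZMod p) ^ 2) * (w₃ : ZMod p))) := by
  rw [torusA_apply, torusB_apply, torusC_apply, upperTri_mul, upperTri_mul]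
  congr 1
  push_cast
  ring

/-- Ranges of upper-triangular-valued homomorphisms are upper triangular. -/
theorem range_lower {G : Type*} [Group G] (f : G →* GLm p 2)
    (hf : ∀ x, ((f x : GLm p 2) : Mat p 2) 1 0 = 0) :
    ∀ u ∈ f.range, (u : Mat p 2) 1 0 = 0 := by
  rintro u ⟨x, rfl⟩
  exact hf x

/-- `A₁` is upper triangular. -/
theorem torusA_lower : ∀ u ∈ (torusA p).range, (u : Mat p 2) 1 0 = 0 :=
  range_lower _ fun ⟨s, z⟩ => by rw [torusA_apply]; exact upperTri_lower _ _ _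

/-- `A₂` is upper triangular. -/
theorem torusB_lower : ∀ u ∈ (torusB p).range, (u : Mat p 2) 1 0 = 0 :=
  range_lower _ fun w => by rw [torusB_apply]; exact upperTri_lower _ _ _

/-- `A₃` is upper triangular. -/
theorem torusC_lower : ∀ u ∈ (torusC p).range, (u : Mat p 2) 1 0 = 0 :=
  range_lower _ fun w => by rw [torusC_apply]; exact upperTri_lower _ _ _

/-- The sign in `a₁` is forced to be `+1` whenever `sign · (square) = 1`. -/
theorem sign_eq_one (hneg : ¬IsSquare (-1 : ZMod p)) (s : ℤˣ) (x : ZMod p)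
    (h : (signHom p s : ZMod p) * x ^ 2 = 1) : s = 1 := by
  rcases Int.units_eq_one_or s with rfl | rfl
  · rfl
  · rw [signHom_neg_one_val] at h
    exact (hneg ⟨x, by linear_combination h⟩).elim

/-! ## TPP, the missing unipotent, cardinalities -/

/-- **The family has the subgroup TPP** (for `-1, 2 ∉ (𝔽_p)²`). -/
theorem borelFamily_tpp (hneg : ¬IsSquare (-1 : ZMod p)) (htwo : ¬IsSquare (2 : ZMod p)) :
    Literature.Barriers.MatrixMultiplication.SubgroupTPP
      (torusA p).range (torusB p).range (torusC p).range := by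
  rintro a ⟨⟨s, z₁⟩, rfl⟩ b ⟨w₂, rfl⟩ c ⟨w₃, rfl⟩ habc
  rw [triple_product, ← upperTri_one] at habc
  obtain ⟨h1, h2, h3⟩ := upperTri_injective habc
  have hp2 := two_ne_of_neg_one_nonsquare hneg
  have h1v : (signHom p s : ZMod p) * ((w₂ : ZMod p) * w₃) ^ 2 = 1 := by
    have := congrArg Units.val h1; push_cast at this; linear_combination this
  have hs : s = 1 := sign_eq_one hneg s _ h1v
  subst hs
  rw [signHom_one_val, one_mul] at h1v h3
  set x₂ : ZMod p := (w₂ : ZMod p) with hx₂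
  set x₃ : ZMod p := (w₃ : ZMod p) with hx₃
  set e : ZMod p := x₂ ^ (p / 2) with he
  have hx₂0 : x₂ ≠ 0 := w₂.ne_zero
  have he2 : e ^ 2 = 1 := pow_half_sq hp2 hx₂0
  -- the key quadratic `e x₃² - 2 x₃ + 1 = 0`
  have key : e * x₃ ^ 2 - 2 * x₃ + 1 = 0 := by
    linear_combination x₃ * h3 + (2 * x₃ - 1) * h1v
  rcases sq_eq_one_or e he2 with he1 | he1
  · -- `e = 1`: `(x₃ - 1)² = 0`
    rw [he1, one_mul] at key
    have hx₃1 : x₃ = 1 := by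
      have h0 : (x₃ - 1) ^ 2 = 0 := by linear_combination key
      exact sub_eq_zero.mp ((pow_eq_zero_iff two_ne_zero).mp h0)
    have hx₂sq : x₂ ^ 2 = 1 := by rw [hx₃1] at h1v; linear_combination h1v
    have hx₂1 : x₂ = 1 := eq_one_of_sq_of_pow_half hneg hx₂sq (by rw [← he1])
    have hw₂ : w₂ = 1 := Units.ext hx₂1
    have hw₃ : w₃ = 1 := Units.ext hx₃1
    have hz₁ : z₁ = 1 := by rw [hw₂, hw₃] at h2; simpa using h2
    refine ⟨?_, by rw [hw₂, map_one], by rw [hw₃, map_one]⟩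
    rw [hz₁, Prod.mk_one_one, map_one]
  · -- `e = -1`: `(x₃ + 1)² = 2`
    rw [he1] at key
    exact (htwo ⟨x₃ + 1, by linear_combination key⟩).elim

/-- **The unipotent `u_{t₀-2}` is missed by `A₁A₂A₃`** when `t₀² ∓ 4` are non-squares. -/
theorem borelFamily_missing (hneg : ¬IsSquare (-1 : ZMod p)) (t₀ : ZMod p)
    (ht₁ : ¬IsSquare (t₀ ^ 2 - 4)) (ht₂ : ¬IsSquare (t₀ ^ 2 + 4)) :
    ∀ a ∈ (torusA p).range, ∀ b ∈ (torusB p).range, ∀ g ∈ (torusC p).range,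
      a * b * g ≠ unipUpper (t₀ - 2) := by
  rintro a ⟨⟨s, z₁⟩, rfl⟩ b ⟨w₂, rfl⟩ g ⟨w₃, rfl⟩ h
  rw [triple_product, unipUpper_eq_upperTri] at h
  obtain ⟨h1, -, h3⟩ := upperTri_injective h
  have hp2 := two_ne_of_neg_one_nonsquare hneg
  have h1v : (signHom p s : ZMod p) * ((w₂ : ZMod p) * w₃) ^ 2 = 1 := by
    have := congrArg Units.val h1; push_cast at this; linear_combination this
  have hs : s = 1 := sign_eq_one hneg s _ h1v
  subst hs
  rw [signHom_one_val, one_mul] at h1v h3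
  set x₂ : ZMod p := (w₂ : ZMod p) with hx₂
  set x₃ : ZMod p := (w₃ : ZMod p) with hx₃
  set e : ZMod p := x₂ ^ (p / 2) with he
  have he2 : e ^ 2 = 1 := pow_half_sq hp2 w₂.ne_zero
  -- the key quadratic `e x₃² - t₀ x₃ + 1 = 0`
  have key : e * x₃ ^ 2 - t₀ * x₃ + 1 = 0 := by
    linear_combination x₃ * h3 + (2 * x₃ - 1) * h1v
  rcases sq_eq_one_or e he2 with he1 | he1
  · rw [he1, one_mul] at key
    exact ht₁ ⟨2 * x₃ - t₀, by linear_combination (-4 : ZMod p) * key⟩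
  · rw [he1] at key
    exact ht₂ ⟨2 * x₃ + t₀, by linear_combination (4 : ZMod p) * key⟩

/-- `(s, z) ↦ diag(s, z)` is injective (`p ≠ 2`). -/
theorem torusA_injective (hneg : ¬IsSquare (-1 : ZMod p)) : Function.Injective (torusA p) := by
  rintro ⟨s, z⟩ ⟨s', z'⟩ h
  rw [torusA_apply, torusA_apply] at h
  obtain ⟨h1, h2, -⟩ := upperTri_injective h
  have hv := congrArg Units.val h1
  have hs : s = s' := by
    rcases Int.units_eq_one_or s with rfl | rfl <;>
      rcases Int.units_eq_one_or s' with rfl | rfl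
    · rfl
    · rw [signHom_one_val, signHom_neg_one_val] at hv
      exact absurd hv.symm (neg_one_ne_one_of_nonsquare hneg)
    · rw [signHom_one_val, signHom_neg_one_val] at hv
      exact absurd hv (neg_one_ne_one_of_nonsquare hneg)
    · rfl
  exact Prod.ext hs h2

/-- `w ↦ u₁ diag(w², w^{(p-1)/2}) u₁⁻¹` is injective when `-1 ∉ (𝔽_p)²`. -/
theorem torusB_injective (hneg : ¬IsSquare (-1 : ZMod p)) : Function.Injective (torusB p) := by
  intro w w' h
  rw [torusB_apply, torusB_apply] at h
  obtain ⟨h1, h2, -⟩ := upperTri_injective h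
  have h1v : (w : ZMod p) ^ 2 = (w' : ZMod p) ^ 2 := by
    have := congrArg Units.val h1; push_cast at this; exact this
  have h2v : (w : ZMod p) ^ (p / 2) = (w' : ZMod p) ^ (p / 2) := by
    have := congrArg Units.val h2; push_cast at this; exact this
  have hw' : (w' : ZMod p) ≠ 0 := w'.ne_zero
  have hr2 : ((w : ZMod p) / w') ^ 2 = 1 := by
    rw [div_pow, h1v, div_self (pow_ne_zero _ hw')]
  have hrh : ((w : ZMod p) / w') ^ (p / 2) = 1 := by
    rw [div_pow, h2v, div_self (pow_ne_zero _ hw')]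
  have hr := eq_one_of_sq_of_pow_half hneg hr2 hrh
  exact Units.ext ((div_eq_one_iff_eq hw').mp hr)

/-- `w ↦ u₂ diag(w², w) u₂⁻¹` is injective. -/
theorem torusC_injective : Function.Injective (torusC p) := by
  intro w w' h
  rw [torusC_apply, torusC_apply] at h
  exact (upperTri_injective h).2.1

/-- The range of an injective homomorphism has the cardinality of its source. [folklore] -/
theorem natCard_range_of_injective {G N : Type*} [Group G] [Group N] (f : G →* N)
    (hf : Function.Injective f) : Nat.card f.range = Nat.card G :=
  (Nat.card_congr (MonoidHom.ofInjective hf).toEquiv).symm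

/-- `|𝔽_pˣ| = p - 1`. [folklore] -/
theorem natCard_units : Nat.card (ZMod p)ˣ = p - 1 := by
  rw [Nat.card_eq_fintype_card, ZMod.card_units]

/-- **Cardinalities**: `|A₁||A₂||A₃| = 2(p-1)³`. -/
theorem borelFamily_card (hneg : ¬IsSquare (-1 : ZMod p)) :
    Nat.card (torusA p).range * Nat.card (torusB p).range * Nat.card (torusC p).range =
      2 * (p - 1) ^ 3 := by
  rw [natCard_range_of_injective _ (torusA_injective hneg),
    natCard_range_of_injective _ (torusB_injective hneg),
    natCard_range_of_injective _ torusC_injective, Nat.card_prod, natCard_units,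
    Nat.card_eq_fintype_card, Fintype.card_units_int]
  ring

/-- **The Borel family `F`**: a TPP triple of subgroups of `GL₂(𝔽_p)` with a rank-`≤ 1` identity
test function and volume `2(p-1)³`, for every prime `p` with `-1, 2 ∉ (𝔽_p)²` admitting `t₀` with
`t₀² - 4, t₀² + 4 ∉ (𝔽_p)²`. [this cell; design via `levelOne_idDesign_of_borel`] -/
theorem borelFamily (hneg : ¬IsSquare (-1 : ZMod p)) (htwo : ¬IsSquare (2 : ZMod p))
    (t₀ : ZMod p) (ht₁ : ¬IsSquare (t₀ ^ 2 - 4)) (ht₂ : ¬IsSquare (t₀ ^ 2 + 4)) :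
    ∃ H₁ H₂ H₃ : Subgroup (Matrix.GeneralLinearGroup (Fin 2) (ZMod p)),
      Literature.Barriers.MatrixMultiplication.SubgroupTPP H₁ H₂ H₃ ∧
      (∃ c : Matrix (Fin 2) (Fin 2) (ZMod p) → ℂ, (∀ M, 1 < M.rank → c M = 0) ∧
        (∑ M : Matrix (Fin 2) (Fin 2) (ZMod p), c M * ZMod.stdAddChar (Matrix.trace
          (M * ((1 : Matrix.GeneralLinearGroup (Fin 2) (ZMod p)) :
            Matrix (Fin 2) (Fin 2) (ZMod p))))) = 1 ∧
        ∀ a ∈ H₁, ∀ b ∈ H₂, ∀ g ∈ H₃, a * b * g ≠ 1 →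
          (∑ M : Matrix (Fin 2) (Fin 2) (ZMod p), c M * ZMod.stdAddChar (Matrix.trace
            (M * ((a * b * g : Matrix.GeneralLinearGroup (Fin 2) (ZMod p)) :
              Matrix (Fin 2) (Fin 2) (ZMod p))))) = 0) ∧
      Nat.card H₁ * Nat.card H₂ * Nat.card H₃ = 2 * (p - 1) ^ 3 := by
  have hy₀ : t₀ - 2 ≠ 0 := by
    intro h
    have ht : t₀ = 2 := sub_eq_zero.mp h
    subst ht
    exact ht₁ (by rw [show (2 : ZMod p) ^ 2 - 4 = 0 by norm_num]; exact IsSquare.zero)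
  exact ⟨(torusA p).range, (torusB p).range, (torusC p).range, borelFamily_tpp hneg htwo,
    levelOne_idDesign_of_borel torusA_lower torusB_lower torusC_lower hy₀
      (borelFamily_missing hneg t₀ ht₁ ht₂),
    borelFamily_card hneg⟩

end Summit.MatrixMultiplication.MatrixMultiplication.Theorems.SubgroupIdentityDesigns.Negative

end
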